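import Mathlib.Analysis.SpecialFunctions.Log.Basic
import Mathlib.RingTheory.Radical.NatInt
import Literature.Barriers.ABC.NoArithmeticDerivative
import HarnessLib

/-!
# Pasten's `abc` estimate (Theorem 3.3): proof of the named fact `Pasten.abc_estimate`

`Literature/Barriers/ABC/NoArithmeticDerivativeAbcEstimateProofs.lean` — second sibling proof
file of `NoArithmeticDerivative.lean` (the first, `NoArithmeticDerivativeProofs.lean`, discharges
`Pasten.exists_adapted_independent`, Lemma 3.5). It discharges the named fact
`Literature.Barriers.ABC.Pasten.abc_estimate` recorded in
`Literature/Barriers/ABC/NoArithmeticDerivative.lean`: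

> **Theorem 3.3 (An abc estimate).** Let `a, b` be coprime positive integers with
> `(a, b) ≠ (1, 1)` and let `ψ ∈ 𝒯(a, b)`. Suppose that `a` and `b` are `ψ`-independent. Writing
> `c = a + b`, we have `c / log c ≤ rad(abc) · ‖ψ‖ / log 2`. [cite: Pasten2021, Thm. 3.3]

(H. Pasten, *Arithmetic derivatives through geometry of numbers*, Canad. Math. Bull. 65 (2022),
no. 4, 906–923, published online 2021, arXiv:2106.16165; §3.2.) The proof below is the printed
one, "analogous to Snyder's proof of Mason's Theorem in the function field setting":

1. `d^ψ n = Σ_{p ∣ n} v_p(n) ψ(ξ_p) (n/p)` is an integer with `n ∣ d^ψ(n) · rad(n)`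
   [cite: Pasten2021, Lemma 3.4] — `intDeriv_cast`, `dvd_intDeriv_mul_radical`;
2. additivity `d^ψ c = d^ψ a + d^ψ b` (`ψ ∈ 𝒯(a,b)`) gives
   `W := W^ψ(a, b) = a · d^ψ c − c · d^ψ a`, so each of the pairwise coprime `a, b, c` divides
   `W · rad(abc)`; hence `abc ∣ W · rad(abc)` and, as `W ≠ 0`, `abc ≤ |W| · rad(abc)`;
3. `Σ_{p ∣ n} v_p(n)/p ≤ log n / (2 log 2)` [cite: Pasten2021, Lemma 2.2] (termwise
   `p log p ≥ 2 log 2`) — `sum_factorization_div_le`; hence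
   `|W| = ab · |Σ_{p∣b} v_p(b) ψ_p / p − Σ_{p∣a} v_p(a) ψ_p / p| ≤ ab ‖ψ‖ (log a + log b)/(2 log 2)
   ≤ ab ‖ψ‖ log c / log 2`;
4. dividing by `ab > 0` and by `log c > 0`: `c / log c ≤ rad(abc) ‖ψ‖ / log 2`.

As in the vendored statement, `‖ψ‖` is any real bound `B` with `|ψ(ξ_p)| ≤ B` for all `p`. The
hypotheses `(a, b) ≠ (1, 1)` and `supp ψ ⊆ supp(abc)` of the fact are not used by the argument
(when `(a, b) = (1, 1)` the independence hypothesis `W^ψ(a,b) ≠ 0` already fails); this is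
visible in the auxiliary statement `abc_estimate_of_additive`.

No new definitions and no new named facts are introduced (D-0026); the integer form of `d^ψ`
is written out as the explicit sum `Σ_{p ∈ primeFactors n} v_p(n) · ψ p · (n / p)`.
-/

namespace Literature.Barriers.ABC.Pasten

open Literature.NumberTheory.DiophantineGeometry UniqueFactorizationMonoid Finset

/-- The integer form of Pasten's arithmetic derivative, cast into a field of characteristic zero:
`Σ_{p ∣ n} v_p(n) ψ_p (n/p) = n · Σ_{p ∣ n} v_p(n) ψ_p / p`
(`d^ψ(n) = n Σ_{p∣n} v_p(n) p⁻¹ ψ(ξ_p)`). [cite: Pasten2021, §2.1 (proof of Lemma 2.2)] -/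
theorem intDeriv_cast {K : Type*} [Field K] [CharZero K] (ψ : ℕ → ℤ) (n : ℕ) :
    ((∑ p ∈ n.primeFactors, (n.factorization p : ℤ) * ψ p * ((n / p : ℕ) : ℤ) : ℤ) : K) =
      (n : K) * ∑ p ∈ n.primeFactors, (n.factorization p : K) * (ψ p : K) / (p : K) := by
  rw [Finset.mul_sum, Int.cast_sum]
  refine Finset.sum_congr rfl fun p hp => ?_
  have hpn : p ∣ n := Nat.dvd_of_mem_primeFactors hp
  have hp0 : (p : K) ≠ 0 := by exact_mod_cast (Nat.prime_of_mem_primeFactors hp).ne_zero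
  simp only [Int.cast_mul, Int.cast_natCast]
  rw [Nat.cast_div hpn hp0]
  ring

/-- Pasten's `d^ψ n ∈ ℚ` (as formalised in `arithDerivWith`, with values in `ℚ`) is the integer
`Σ_{p ∣ n} v_p(n) ψ_p (n/p)`; in particular `d^ψ : ℤ → ℤ`. [cite: Pasten2021, §2.1] -/
theorem arithDerivWith_eq_intCast (ψ : ℕ → ℤ) (n : ℕ) :
    arithDerivWith ψ n =
      ((∑ p ∈ n.primeFactors, (n.factorization p : ℤ) * ψ p * ((n / p : ℕ) : ℤ) : ℤ) : ℚ) := by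
  rw [intDeriv_cast, arithDerivWith, Finsupp.sum, Nat.support_factorization]

/-- **Lemma 3.4** (Pasten): `n` divides `d^ψ(n) · rad(n)` — each summand
`v_p(n) ψ_p (n/p) · rad(n) = n · v_p(n) ψ_p · (rad(n)/p)` is a multiple of `n` because
`p ∣ rad(n)`. [cite: Pasten2021, Lemma 3.4] -/
theorem dvd_intDeriv_mul_radical (ψ : ℕ → ℤ) (n : ℕ) :
    (n : ℤ) ∣ (∑ p ∈ n.primeFactors, (n.factorization p : ℤ) * ψ p * ((n / p : ℕ) : ℤ)) *
      ((radical n : ℕ) : ℤ) := by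
  rw [Finset.sum_mul]
  refine Finset.dvd_sum fun p hp => ?_
  have hpn : p ∣ n := Nat.dvd_of_mem_primeFactors hp
  have hprad : p ∣ radical n := by
    rw [Nat.radical_eq_prod_primeFactors]
    exact Finset.dvd_prod_of_mem _ hp
  obtain ⟨r, hr⟩ := hprad
  have key : n / p * radical n = n * r := by
    rw [hr, ← mul_assoc, Nat.div_mul_cancel hpn]
  refine ⟨(n.factorization p : ℤ) * ψ p * r, ?_⟩
  calc (n.factorization p : ℤ) * ψ p * ((n / p : ℕ) : ℤ) * ((radical n : ℕ) : ℤ)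
      = (n.factorization p : ℤ) * ψ p * ((n / p * radical n : ℕ) : ℤ) := by push_cast; ring
    _ = (n.factorization p : ℤ) * ψ p * ((n * r : ℕ) : ℤ) := by rw [key]
    _ = (n : ℤ) * ((n.factorization p : ℤ) * ψ p * r) := by push_cast; ring

/-- **Lemma 2.2** (Pasten): `Σ_{p ∣ n} v_p(n) / p ≤ log n / (2 log 2)` for every natural `n`
(both sides vanish for `n ≤ 1`), since `Σ_p v_p(n) log p = log n` and `p log p ≥ 2 log 2` for
every prime `p`. [cite: Pasten2021, Lemma 2.2] -/
theorem sum_factorization_div_le (n : ℕ) :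
    ∑ p ∈ n.primeFactors, (n.factorization p : ℝ) / (p : ℝ) ≤ Real.log n / (2 * Real.log 2) := by
  have hlog : Real.log n = ∑ p ∈ n.primeFactors, (n.factorization p : ℝ) * Real.log p := by
    rw [Real.log_nat_eq_sum_factorization, Finsupp.sum, Nat.support_factorization]
  have hlog2 : 0 < Real.log 2 := Real.log_pos one_lt_two
  have h2 : 0 < 2 * Real.log 2 := by positivity
  rw [le_div_iff₀ h2, hlog, Finset.sum_mul]
  refine Finset.sum_le_sum fun p hp => ?_
  have hpp := Nat.prime_of_mem_primeFactors hp
  have hp2 : (2 : ℝ) ≤ p := by exact_mod_cast hpp.two_le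
  have hp0 : (0 : ℝ) < p := by linarith
  have hlogp : Real.log 2 ≤ Real.log p := Real.log_le_log two_pos hp2
  have hk : (0 : ℝ) ≤ n.factorization p := Nat.cast_nonneg _
  have hplogp : 2 * Real.log 2 ≤ Real.log p * p := by
    rw [mul_comm (Real.log p)]
    exact mul_le_mul hp2 hlogp hlog2.le hp0.le
  rw [div_mul_eq_mul_div, div_le_iff₀ hp0]
  calc (n.factorization p : ℝ) * (2 * Real.log 2) ≤ (n.factorization p : ℝ) * (Real.log p * p) :=
        mul_le_mul_of_nonneg_left hplogp hk
    _ = (n.factorization p : ℝ) * Real.log p * p := by ring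

/-- The bound `|Σ_{p ∣ n} v_p(n) ψ_p / p| ≤ ‖ψ‖ · log n / (2 log 2)` used in the proof of
Theorem 3.3 (from Lemma 2.2), for any bound `B ≥ |ψ_p|`. [cite: Pasten2021, §3.2 (proof of Thm. 3.3)] -/
theorem abs_sum_factorization_mul_div_le (ψ : ℕ → ℤ) {B : ℝ} (hB : ∀ p : ℕ, (|ψ p| : ℝ) ≤ B)
    (n : ℕ) :
    |∑ p ∈ n.primeFactors, (n.factorization p : ℝ) * (ψ p : ℝ) / (p : ℝ)| ≤
      B * (Real.log n / (2 * Real.log 2)) := by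
  have hB0 : 0 ≤ B := le_trans (by positivity) (hB 0)
  calc |∑ p ∈ n.primeFactors, (n.factorization p : ℝ) * (ψ p : ℝ) / (p : ℝ)|
      ≤ ∑ p ∈ n.primeFactors, |(n.factorization p : ℝ) * (ψ p : ℝ) / (p : ℝ)| :=
        Finset.abs_sum_le_sum_abs _ _
    _ ≤ ∑ p ∈ n.primeFactors, B * ((n.factorization p : ℝ) / (p : ℝ)) := by
        refine Finset.sum_le_sum fun p _ => ?_
        have hk : (0 : ℝ) ≤ n.factorization p := Nat.cast_nonneg _
        have hp0 : (0 : ℝ) ≤ p := Nat.cast_nonneg _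
        have hψ : |(ψ p : ℝ)| ≤ B := by exact_mod_cast hB p
        rw [abs_div, abs_mul, Nat.abs_cast, Nat.abs_cast]
        calc (n.factorization p : ℝ) * |(ψ p : ℝ)| / p ≤ (n.factorization p : ℝ) * B / p :=
              div_le_div_of_nonneg_right (mul_le_mul_of_nonneg_left hψ hk) hp0
          _ = B * ((n.factorization p : ℝ) / (p : ℝ)) := by ring
    _ = B * ∑ p ∈ n.primeFactors, (n.factorization p : ℝ) / (p : ℝ) := (Finset.mul_sum _ _ _).symm
    _ ≤ B * (Real.log n / (2 * Real.log 2)) :=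
        mul_le_mul_of_nonneg_left (sum_factorization_div_le n) hB0

/-- **Theorem 3.3 with only the hypotheses the printed proof uses**: for coprime positive `a, b`,
`c = a + b`, any `ψ` (values `ψ p = ψ(ξ_p)` at primes) whose arithmetic derivative is additive on
`a + b = c` and for which `a, b` are `ψ`-independent (`W^ψ(a,b) ≠ 0`), and any bound
`B ≥ |ψ(ξ_p)|`, one has `c / log c ≤ rad(abc) · B / log 2`. [cite: Pasten2021, Thm. 3.3] -/
theorem abc_estimate_of_additive {a b c : ℕ} {ψ : ℕ → ℤ} {B : ℝ} (ha : 0 < a) (hb : 0 < b)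
    (hc : a + b = c) (hcop : Nat.Coprime a b)
    (hadd : arithDerivWith ψ c = arithDerivWith ψ a + arithDerivWith ψ b)
    (hW : wronskian ψ a b ≠ 0) (hB : ∀ p : ℕ, (|ψ p| : ℝ) ≤ B) :
    (c : ℝ) / Real.log c ≤ (rad a b c : ℝ) * B / Real.log 2 := by
  have hc0 : 0 < c := by omega
  have hac : a ≤ c := by omega
  have hbc : b ≤ c := by omega
  have h2c : 2 ≤ c := by omega
  have hB0 : 0 ≤ B := le_trans (by positivity) (hB 0)
  have hlog2 : 0 < Real.log 2 := Real.log_pos one_lt_two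
  have hlogc : 0 < Real.log c := Real.log_pos (by exact_mod_cast h2c)
  -- Step 1: the arithmetic derivatives are integers `Da, Db, Dc`.
  have hQa := arithDerivWith_eq_intCast ψ a
  have hQb := arithDerivWith_eq_intCast ψ b
  have hQc := arithDerivWith_eq_intCast ψ c
  have hRa := intDeriv_cast (K := ℝ) ψ a
  have hRb := intDeriv_cast (K := ℝ) ψ b
  have hDa := dvd_intDeriv_mul_radical ψ a
  have hDb := dvd_intDeriv_mul_radical ψ b
  have hDc := dvd_intDeriv_mul_radical ψ c
  generalize (∑ p ∈ a.primeFactors, (a.factorization p : ℤ) * ψ p * ((a / p : ℕ) : ℤ)) = Da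
    at hQa hRa hDa
  generalize (∑ p ∈ b.primeFactors, (b.factorization p : ℤ) * ψ p * ((b / p : ℕ) : ℤ)) = Db
    at hQb hRb hDb
  generalize (∑ p ∈ c.primeFactors, (c.factorization p : ℤ) * ψ p * ((c / p : ℕ) : ℤ)) = Dc
    at hQc hDc
  -- additivity on `a + b = c`, in `ℤ`
  have hadd' : Dc = Da + Db := by
    rw [hQa, hQb, hQc] at hadd
    exact_mod_cast hadd
  -- Step 2: the Wronskian `W = a Db - b Da ∈ ℤ` is non-zero and `abc ∣ W · rad(abc)`.
  obtain ⟨W, hWdef⟩ : ∃ W : ℤ, (a : ℤ) * Db - (b : ℤ) * Da = W := ⟨_, rfl⟩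
  have hW0 : W ≠ 0 := by
    intro h0
    apply hW
    rw [wronskian, hQa, hQb]
    rw [← hWdef] at h0
    exact_mod_cast h0
  have habc0 : a * b * c ≠ 0 := by positivity
  obtain ⟨R, hR⟩ : ∃ R : ℕ, radical (a * b * c) = R := ⟨_, rfl⟩
  have hRpos : 0 < R := hR ▸ Nat.radical_pos _
  have hrad_a : ((radical a : ℕ) : ℤ) ∣ (R : ℤ) :=
    Int.natCast_dvd_natCast.mpr (hR ▸ radical_dvd_radical (Dvd.intro (b * c) (by ring)) habc0)
  have hrad_b : ((radical b : ℕ) : ℤ) ∣ (R : ℤ) :=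
    Int.natCast_dvd_natCast.mpr (hR ▸ radical_dvd_radical (Dvd.intro (a * c) (by ring)) habc0)
  have hrad_c : ((radical c : ℕ) : ℤ) ∣ (R : ℤ) :=
    Int.natCast_dvd_natCast.mpr (hR ▸ radical_dvd_radical (Dvd.intro_left (a * b) rfl) habc0)
  have hdvd_a : (a : ℤ) ∣ W * R := by
    have h1 : (a : ℤ) ∣ Da * R := hDa.trans (mul_dvd_mul_left _ hrad_a)
    have : W * R = a * (Db * R) - b * (Da * R) := by rw [← hWdef]; ring
    rw [this]
    exact dvd_sub (dvd_mul_right _ _) (dvd_mul_of_dvd_right h1 _)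
  have hdvd_b : (b : ℤ) ∣ W * R := by
    have h1 : (b : ℤ) ∣ Db * R := hDb.trans (mul_dvd_mul_left _ hrad_b)
    have : W * R = a * (Db * R) - b * (Da * R) := by rw [← hWdef]; ring
    rw [this]
    exact dvd_sub (dvd_mul_of_dvd_right h1 _) (dvd_mul_right _ _)
  have hdvd_c : (c : ℤ) ∣ W * R := by
    have h1 : (c : ℤ) ∣ Dc * R := hDc.trans (mul_dvd_mul_left _ hrad_c)
    have hcz : (c : ℤ) = a + b := by exact_mod_cast hc.symm
    have : W * R = a * (Dc * R) - c * (Da * R) := by rw [← hWdef, hadd', hcz]; ring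
    rw [this]
    exact dvd_sub (dvd_mul_of_dvd_right h1 _) (dvd_mul_right _ _)
  have hcop_ac : Nat.Coprime a c := by rw [← hc]; exact Nat.coprime_self_add_right.mpr hcop
  have hcop_bc : Nat.Coprime b c := by rw [← hc]; exact Nat.coprime_add_self_right.mpr hcop.symm
  have hdvd : ((a * b * c : ℕ) : ℤ) ∣ W * R := by
    have hab : IsCoprime (a : ℤ) (b : ℤ) := Nat.isCoprime_iff_coprime.mpr hcop
    have habc' : IsCoprime ((a * b : ℕ) : ℤ) (c : ℤ) :=
      Nat.isCoprime_iff_coprime.mpr (Nat.Coprime.mul_left hcop_ac hcop_bc)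
    have h2 : ((a * b : ℕ) : ℤ) ∣ W * R := by push_cast; exact hab.mul_dvd hdvd_a hdvd_b
    have h3 := habc'.mul_dvd h2 hdvd_c
    push_cast at h3 ⊢
    exact h3
  -- hence `abc ≤ |W| · rad(abc)`
  have hle_int : ((a * b * c : ℕ) : ℤ) ≤ |W| * R := by
    have hpos : 0 < |W| * (R : ℤ) := by positivity
    refine Int.le_of_dvd hpos ?_
    have habs : |W * (R : ℤ)| = |W| * R := by rw [abs_mul, Nat.abs_cast]
    rw [← habs, dvd_abs]
    exact hdvd
  have hle_real : (a : ℝ) * b * c ≤ |(W : ℝ)| * R := by exact_mod_cast hle_int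
  -- Step 3: `|W| ≤ ab · B · log c / log 2`.
  have hWreal : (W : ℝ) = a * b *
      ((∑ p ∈ b.primeFactors, (b.factorization p : ℝ) * (ψ p : ℝ) / (p : ℝ)) -
        ∑ p ∈ a.primeFactors, (a.factorization p : ℝ) * (ψ p : ℝ) / (p : ℝ)) := by
    rw [← hWdef]
    push_cast
    rw [hRa, hRb]
    ring
  have hloga : Real.log a ≤ Real.log c := Real.log_le_log (by exact_mod_cast ha) (by exact_mod_cast hac)
  have hlogb : Real.log b ≤ Real.log c := Real.log_le_log (by exact_mod_cast hb) (by exact_mod_cast hbc)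
  have hWabs : |(W : ℝ)| ≤ a * b * (B * (Real.log c / Real.log 2)) := by
    rw [hWreal, abs_mul, abs_of_nonneg (by positivity : (0 : ℝ) ≤ a * b)]
    refine mul_le_mul_of_nonneg_left ?_ (by positivity)
    calc |(∑ p ∈ b.primeFactors, (b.factorization p : ℝ) * (ψ p : ℝ) / (p : ℝ)) -
            ∑ p ∈ a.primeFactors, (a.factorization p : ℝ) * (ψ p : ℝ) / (p : ℝ)|
        ≤ |∑ p ∈ b.primeFactors, (b.factorization p : ℝ) * (ψ p : ℝ) / (p : ℝ)| +
            |∑ p ∈ a.primeFactors, (a.factorization p : ℝ) * (ψ p : ℝ) / (p : ℝ)| := abs_sub _ _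
      _ ≤ B * (Real.log b / (2 * Real.log 2)) + B * (Real.log a / (2 * Real.log 2)) :=
          add_le_add (abs_sum_factorization_mul_div_le ψ hB b)
            (abs_sum_factorization_mul_div_le ψ hB a)
      _ ≤ B * (Real.log c / (2 * Real.log 2)) + B * (Real.log c / (2 * Real.log 2)) := by
          gcongr
      _ = B * (Real.log c / Real.log 2) := by
          field_simp
          ring
  -- Step 4: divide by `ab` and by `log c`.
  have hab0 : (0 : ℝ) < a * b := by positivity
  have hmain : (c : ℝ) ≤ B * (Real.log c / Real.log 2) * R := by
    have h1 : (a : ℝ) * b * c ≤ a * b * (B * (Real.log c / Real.log 2) * R) := by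
      calc (a : ℝ) * b * c ≤ |(W : ℝ)| * R := hle_real
        _ ≤ a * b * (B * (Real.log c / Real.log 2)) * R :=
            mul_le_mul_of_nonneg_right hWabs (by positivity)
        _ = a * b * (B * (Real.log c / Real.log 2) * R) := by ring
    exact le_of_mul_le_mul_left h1 hab0
  have hRrad : rad a b c = R := hR
  rw [hRrad, div_le_iff₀ hlogc]
  calc (c : ℝ) ≤ B * (Real.log c / Real.log 2) * R := hmain
    _ = (R : ℝ) * B / Real.log 2 * Real.log c := by ring

/-- **Discharge of `Pasten.abc_estimate`** (Pasten, Theorem 3.3: for coprime positive `a, b` with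
`(a, b) ≠ (1, 1)`, `c = a + b`, `ψ ∈ 𝒯(a,b)` with `a, b` `ψ`-independent,
`c / log c ≤ rad(abc) · ‖ψ‖ / log 2`), by the printed argument: Lemma 3.4, pairwise coprimality,
and Lemma 2.2; see the module docstring. [cite: Pasten2021, Thm. 3.3] -/
theorem abc_estimate_holds : abc_estimate := by
  intro a b ψ B habc _ hψ hW hB
  exact abc_estimate_of_additive habc.1 habc.2.1 rfl habc.2.2.2 hψ.2 hW hB

end Literature.Barriers.ABC.Pasten
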